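import Mathlib
import Summits.QuantumFields.YangMills.Theses.DirichletWindow
import Summits.QuantumFields.YangMills.Theorems.ConvexGribovBodyContinuumLegGivenGapStubLock
import HarnessLib

/-!
# `ContinuumFromLatticeGap` (stmt-QuantumFields-15915), line `registered` (reshape 1b): `stub_criticalOfLock`

Support file for the crux item stmt-QuantumFields-15915 (registered stub `stub_criticalOfLock` of the
line `registered`): **criticality of locked rates, from the lock alone**. At a compact simple `(G, r)`
(general Borel σ-algebra), under `DirichletWindow.XiDiverges` (stmt-QuantumFields-8941, taken as a
HYPOTHESIS by name): every sequence of couplings `β_k → +∞` equipped with rates `m̂_k > 0`, volume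
thresholds `S₁ k` and `k`-UNIFORM pair constants for the connected time correlations on the odd tori
`(ℤ/(2S+1))⁴` (`S₁ k ≤ S`, `n ≤ S`) has `m̂_k → 0`.

Unlike the sibling `ContinuumLegGivenGap.stub_critical` (stmt-QuantumFields-15828), no clustering on a
half-line `[β₀, ∞)` is assumed: no rate function is spliced. Proof: `m̂_k > 0` gives the lower side of
the order-topology criterion; for the upper side fix `m₀ > 0`, let `β₁` be the coupling beyond which
rate `m₀` is SHARP for the plaquette pair (`sharp_eventually_of_xiDiverges`); for all large `k`,
`β_k ≥ β₁`, and the UNIFORM clause at index `k` is an admissible clustering at rate `m̂_k` at `β_k`, so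
`rate_lt_of_sharp` gives `m̂_k < m₀`.

Pure logic over the landed tree lemmas of `ConvexGribovBodyContinuumLegGivenGapStubLock`; no
definitions, no facts. [folklore]
-/

noncomputable section

namespace Summit.QuantumFields.YangMills.Theorems.ContinuumFromLatticeGap

open Filter Topology
open Literature.MathematicalPhysics.QuantumFieldTheory
open Literature.MathematicalPhysics.QuantumLattice
open Summit.QuantumFields.YangMills.Theses
open Summit.QuantumFields.YangMills.Theorems.ContinuumLegGivenGap

/-- **`stub_criticalOfLock`** (registered stub of stmt-QuantumFields-15915, line `registered`): under
`DirichletWindow.XiDiverges`, at a compact simple `(G, r)`, couplings `β_k → +∞` with rates `m̂_k > 0`,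
thresholds `S₁ k` and `k`-uniform pair constants have `m̂_k → 0`. For `m₀ > 0`, rate `m₀` is
eventually sharp (`sharp_eventually_of_xiDiverges`), and at every such `β_k` the uniform clause at
index `k` is an admissible clustering at rate `m̂_k`, whence `m̂_k < m₀` (`rate_lt_of_sharp`).
[folklore] -/
theorem stub_criticalOfLock :
    DirichletWindow.XiDiverges →
    ∀ (G : Type) [Group G] [TopologicalSpace G] [IsTopologicalGroup G] [CompactSpace G]
      [MeasurableSpace G] [BorelSpace G], IsCompactSimpleLieGroup G → ∀ r : LatticeRep G,
      ∀ (β : ℕ → ℝ) (mh : ℕ → ℝ) (S₁ : ℕ → ℕ), Tendsto β atTop atTop → (∀ k, 0 < mh k) →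
        (∀ A B : YMSpecies G, ∃ C : ℝ, ∀ k S n : ℕ, S₁ k ≤ S → n ≤ S →
          |latticeConnectedCorr r.ρ (β k) (2 * S + 1) A.F B.F n| ≤ C * Real.exp (-(mh k * n))) →
        Tendsto mh atTop (𝓝 0) := by
  intro hXi G _ _ _ _ _ _ hG r β mh S₁ hβ hmh hunif
  refine tendsto_order.2
    ⟨fun a ha => Eventually.of_forall fun k => ha.trans (hmh k), fun m₀ hm₀ => ?_⟩
  obtain ⟨β₁, hβ₁⟩ := sharp_eventually_of_xiDiverges hXi hG r m₀ hm₀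
  filter_upwards [hβ.eventually (eventually_ge_atTop β₁)] with k hk
  exact rate_lt_of_sharp r (β k) m₀ (mh k) (S₁ k)
    (fun A B => (hunif A B).imp fun C hC S n hS hn => hC k S n hS hn) (hβ₁ (β k) hk)

end Summit.QuantumFields.YangMills.Theorems.ContinuumFromLatticeGap

end
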